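/-
Copyright (c) 2026 the pub-hodgecm-mathlib formalisation cell (harness21).  Prover seat hodgecm-mathlib-B-p14 (g36): road «S3-tree» (chair F0P3a-plan (g11); architect A-p16 (g30) A-88 (4);
T10-42 (3) S3-res capital), brick T1 «the `U(3)_v` tree», DATUM-FREE EDITION R5a = THE APARTMENT AND THE PARENT OF A SELF-DUAL VERTEX FOR ANY ISOMETRIC INVOLUTION; 2026-09-01.
Twin of ★ T1d-A `UnitaryLatticeTreeApartment` §§ (apartment vertices) and ★ T1d-B `UnitaryLatticeTreeParent` (the parent of a self-dual vertex, given its frame).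
-/
import Literature.NumberTheory.Automorphic.UnitaryLatticeTreeParent                      -- ★ T1d-B (B-p14 (g35)): `latt_diagonal_three_inf_scaleLattice`, `latt_diagonal_zpow_zero`, `diagonal_one_mid_eq`; brings ★ T1d-A Apartment
import Literature.NumberTheory.Automorphic.UnitaryLatticeTreeFixedCostarCoordsRamified   -- ★ (F0P3a-p07 (g11)): `dualLatt_latt_diagonal_antidiagonal` (`σϖ`-free duals of diagonal lattices)
import Literature.NumberTheory.Automorphic.UnitaryLatticeTreeStarOfInvolution            -- ★ T1e R1 (B-p14 (g36)): `isSelfDualLattice_stdLattice_three_of_v`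
import HarnessLib

/-!
# The lattice graph of a hermitian space — T1 FILE R5a: THE APARTMENT `{L_a, L′_a}` AND THE PARENT OF A SELF-DUAL VERTEX, FOR ANY ISOMETRIC INVOLUTION
# (no `σϖ = ϖ`: ramified places included; Bruhat–Tits 1972 §10, Tits 1979 §3.3.3, Serre *Trees* II.1.1)

Topic `NumberTheory/Automorphic`; namespace `Literature.NumberTheory.Automorphic.UnitaryLatticeTree`.  THEOREMS ONLY (no definition, no instance, no notation, no named fact,
no `sorry`); kernel lane.  Cell `pub/hodgecm-mathlib` (D-0151), crux H413 = `stmt-HodgeConjecture-24833`; road «S3-tree», brick T1 «the `U(3)_v` lattice graph is a TREE»,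
DATUM-FREE EDITION (S3-res capital: the tame-ramified residue letter needs tree-ness `hT` at places where `σϖ = −ϖ`, ★ `isTree_latticeGraph_three` being proved under the
UNRAMIFIED datum only).  The ★ T1d chain (Apartment → Parent → TypeTwoNormalForm → TypeTwoParent → TypeTwoChild → IsTree) uses `σϖ = ϖ` only to see that the `ϖ`-power diagonal
matrices `t_a = diag(ϖ^a, 1, ϖ^{−a})` are unitary.  For ANY involution `σ` preserving `v` the unitary torus element is `diag(ϖ^a, 1, (σϖ)^{−a})` (★ `UnitaryGroup.exists_coe_eq_torusDiag`),
and it spans the SAME lattices, since `|σϖ| = |ϖ|` and a diagonal lattice only sees valuations (★ `latt_diagonal_congr`).  This file re-issues the apartment facts and the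
PARENT OF A SELF-DUAL VERTEX in that generality; the frame of the vertex (`L = κ·L_a`, `κ ∈ K₀`) is taken as a HYPOTHESIS here (it is supplied by the Cartan decomposition
★ `UnitaryGroup.exists_cartan_of_involution` + transitivity, filed separately), so that this file stays in the pure `[Valued K ℤᵐ⁰]` currency of ★ T1a.

* §1 `exists_coe_eq_diagonal_zpow_of_involution` (`diag(ϖ^a, 1, (σϖ)^{−a}) ∈ U(σ, J₀)`), `latt_diagonal_map_zpow_eq` ∕ `latt_diagonal_map_zpow_mul_eq` (diagonal lattices only see valuations).
* §2 **`isSelfDualLattice_latt_diagonal_zpow_of_v`** (`L_a` self-dual), **`isVertexLattice_two_N₁_of_v`** (`N₁ = latt diag(1,1,ϖ)` is of type `2` for ANY valuation-preserving `σ` —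
  supersedes ★ `isVertexLattice_two_latt_diagonal_one_one` (`σϖ = ϖ`) and ★ `isVertexLattice_two_N₁_of_neg` (`σϖ = −ϖ`)), **`isVertexLattice_two_latt_diagonal_zpow_of_v`** (`L′_a` of type `2`).
* §3 `dualLatt_latt_diagonal_three_of_v` (`(latt diag(ϖ^a,ϖ^b,ϖ^c))^♯ = latt diag(ϖ^{−c},ϖ^{−b},ϖ^{−a})`, over ★ `dualLatt_latt_diagonal_antidiagonal`).
* §4 **`latticeParent_spec_of_isSelfDualLattice_of_frame`**: for `κ ∈ K₀`, `a : ℤ` and `L = κ·L_a ≠ 𝒪³`: `depth L ≥ 1`, `latticeParent L` is of type `2`, strictly below `L`, of the same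
  depth — ★ `latticeParent_spec_of_isSelfDualLattice` with the frame as input and `hd ↦ (hσ, hvσ, hϖ)`.

HONEST LABEL: HC_CM is proved only modulo the 2 remaining named inputs (hLiu418 24832, h413 24833) until rung 0 closes; nothing printed is asserted here (elementary lattice algebra).

## References
* [BruhatTits1972] F. Bruhat, J. Tits, *Groupes réductifs sur un corps local I*, Publ. Math. IHÉS 41 (1972), §10.
* [Tits1979] J. Tits, *Reductive groups over local fields*, PSPM 33.1 (1979), §2.4, §3.3.3.
* [Serre1980Trees] J.-P. Serre, *Trees* (1980), Ch. II §1.1.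
* [Jacobowitz1962] R. Jacobowitz, *Hermitian forms over local fields*, Amer. J. Math. 84 (1962), §4, §7–§8.
-/

set_option autoImplicit false

noncomputable section

open scoped Valued WithZero Matrix MatrixGroups

namespace Literature.NumberTheory.Automorphic.UnitaryLatticeTree

open Literature.NumberTheory.Automorphic Literature.NumberTheory.Automorphic.HermitianLattice
open Literature.NumberTheory.Automorphic.CartanUnique

variable {K : Type*} [Field K] [Valued K ℤᵐ⁰] {σ : K →+* K} {ϖ : K}

/-! ## §1 The torus elements `diag(ϖ^a, 1, (σϖ)^{−a})` and the lattices they span -/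

omit [Valued K ℤᵐ⁰] in
/-- **The torus element `diag(ϖ^a, 1, (σϖ)^{−a}) ∈ U(σ, J₀)`** for ANY involution `σ` and `ϖ ≠ 0` (★ `UnitaryGroup.exists_coe_eq_torusDiag`). [cite: BruhatTits1972, §10] [cite: Tits1979, §3.3.3] -/
theorem exists_coe_eq_diagonal_zpow_of_involution (hσ : ∀ x, σ (σ x) = x) (hϖ0 : ϖ ≠ 0) (a : ℤ) :
    ∃ t : unitaryGroupOfForm σ ((StdForm.antidiagonal 3).over K), ((t : GL (Fin 3) K) : Matrix (Fin 3) (Fin 3) K) = Matrix.diagonal ![ϖ ^ a, 1, (σ ϖ) ^ (-a)] := by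
  obtain ⟨t, ht⟩ := UnitaryGroup.exists_coe_eq_torusDiag σ rfl hσ (zpow_ne_zero a hϖ0)
  refine ⟨t, ?_⟩
  rw [ht, diagonal_three_eq, map_zpow₀, ← zpow_neg]

/-- **Diagonal lattices only see valuations** (i): `latt diag(ϖ^a, 1, (σϖ)^b) = latt diag(ϖ^a, 1, ϖ^b)` for `σ` valuation-preserving (★ `latt_diagonal_congr`). [cite: Serre1980Trees, II.1.1] -/
theorem latt_diagonal_map_zpow_eq (hvσ : ∀ a, Valued.v (σ a) = Valued.v a) (hϖ0 : ϖ ≠ 0) (a b : ℤ) :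
    latt (Matrix.diagonal ![ϖ ^ a, (1 : K), (σ ϖ) ^ b]) = latt (Matrix.diagonal ![ϖ ^ a, (1 : K), ϖ ^ b]) := by
  have hσϖ0 : σ ϖ ≠ 0 := (map_ne_zero σ).2 hϖ0
  refine latt_diagonal_congr (fun i => ?_) (fun i => ?_)
  · fin_cases i
    · exact zpow_ne_zero a hϖ0
    · exact one_ne_zero
    · exact zpow_ne_zero b hσϖ0
  · fin_cases i
    · rfl
    · rfl
    · change Valued.v ((σ ϖ) ^ b) = Valued.v (ϖ ^ b)
      rw [map_zpow₀, map_zpow₀, hvσ]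

/-- **Diagonal lattices only see valuations** (ii): `latt diag(ϖ^a, 1, (σϖ)^b · ϖ) = latt diag(ϖ^a, 1, ϖ^{b+1})`. [cite: Serre1980Trees, II.1.1] -/
theorem latt_diagonal_map_zpow_mul_eq (hvσ : ∀ a, Valued.v (σ a) = Valued.v a) (hϖ0 : ϖ ≠ 0) (a b : ℤ) :
    latt (Matrix.diagonal ![ϖ ^ a, (1 : K), (σ ϖ) ^ b * ϖ]) = latt (Matrix.diagonal ![ϖ ^ a, (1 : K), ϖ ^ (b + 1)]) := by
  have hσϖ0 : σ ϖ ≠ 0 := (map_ne_zero σ).2 hϖ0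
  refine latt_diagonal_congr (fun i => ?_) (fun i => ?_)
  · fin_cases i
    · exact zpow_ne_zero a hϖ0
    · exact one_ne_zero
    · exact mul_ne_zero (zpow_ne_zero b hσϖ0) hϖ0
  · fin_cases i
    · rfl
    · rfl
    · change Valued.v ((σ ϖ) ^ b * ϖ) = Valued.v (ϖ ^ (b + 1))
      rw [map_mul, map_zpow₀, hvσ, zpow_add_one₀ hϖ0, map_mul, map_zpow₀]

/-! ## §2 The apartment vertices and `N₁`, for any valuation-preserving involution -/

/-- **The apartment vertices `L_a = latt diag(ϖ^a, 1, ϖ^{−a})` are self-dual** for ANY involution `σ` preserving `v` (`L_a = diag(ϖ^a,1,(σϖ)^{−a}) · 𝒪³`). [cite: BruhatTits1972, §10] [cite: Serre1980Trees, II.1.1] -/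
theorem isSelfDualLattice_latt_diagonal_zpow_of_v (hσ : ∀ x, σ (σ x) = x) (hvσ : ∀ a, Valued.v (σ a) = Valued.v a) (hϖ : Valued.v ϖ = WithZero.exp (-1 : ℤ)) (a : ℤ) :
    IsSelfDualLattice σ ϖ ((StdForm.antidiagonal 3).over K) (latt (Matrix.diagonal ![ϖ ^ a, 1, ϖ ^ (-a)])) := by
  have hϖ0 : ϖ ≠ 0 := uniformizer_ne_zero hϖ
  obtain ⟨t, ht⟩ := exists_coe_eq_diagonal_zpow_of_involution (K := K) hσ hϖ0 a
  have h1 : latt (Matrix.diagonal ![ϖ ^ a, 1, ϖ ^ (-a)]) = mapGL (t : GL (Fin 3) K) (stdLattice K 3) := by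
    rw [← latt_one, mapGL_coe_latt_eq t ht, Matrix.mul_one, latt_diagonal_map_zpow_eq hvσ hϖ0]
  rw [h1]
  exact isVertexLattice_mapGL σ ϖ _ _ t.2 (isSelfDualLattice_stdLattice_three_of_v hϖ)

/-- **`N₁ = latt diag(1, 1, ϖ)` is a vertex of type `2` for ANY valuation-preserving `σ`** (Gram `[[0,0,ϖ],[0,1,0],[σϖ,0,0]]`, `ϖ·Gram⁻¹ = [[0,0,ϖ∕σϖ],[0,ϖ,0],[1,0,0]]`, `|det| = |ϖ|²`) —
supersedes ★ `isVertexLattice_two_latt_diagonal_one_one` (`σϖ = ϖ`) and ★ `isVertexLattice_two_N₁_of_neg` (`σϖ = −ϖ`). [cite: BruhatTits1972, §10] [cite: Jacobowitz1962, §8] -/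
theorem isVertexLattice_two_N₁_of_v (hvσ : ∀ a, Valued.v (σ a) = Valued.v a) (hϖ1 : Valued.v ϖ ≤ 1) (hϖ0 : ϖ ≠ 0) :
    IsVertexLattice σ ϖ ((StdForm.antidiagonal 3).over K) 2 (latt (Matrix.diagonal ![(1 : K), 1, ϖ])) := by
  have hσϖ0 : σ ϖ ≠ 0 := (map_ne_zero σ).2 hϖ0
  have hσϖ1 : Valued.v (σ ϖ) ≤ 1 := by rw [hvσ]; exact hϖ1
  have hdet : (Matrix.diagonal ![(1 : K), 1, ϖ]).det ≠ 0 := by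
    rw [Matrix.det_diagonal]; simp [Fin.prod_univ_three, hϖ0]
  refine ⟨Matrix.GeneralLinearGroup.mkOfDetNeZero _ hdet, by rw [Matrix.GeneralLinearGroup.val_mkOfDetNeZero], ?_⟩
  have hJ : ∀ i j : Fin 3, ((StdForm.antidiagonal 3).over K) i j = if j = Fin.rev i then (1 : K) else 0 := by
    intro i j
    simp only [StdForm.over, Matrix.map_apply, StdForm.antidiagonal_J_apply]
    split_ifs <;> simp
  have hG : formCongr σ (Matrix.GeneralLinearGroup.mkOfDetNeZero _ hdet) ((StdForm.antidiagonal 3).over K) = !![0, 0, ϖ; 0, 1, 0; σ ϖ, 0, 0] := by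
    rw [formCongr, Matrix.GeneralLinearGroup.val_mkOfDetNeZero]
    ext i j
    fin_cases i <;> fin_cases j <;> simp [Matrix.mul_apply, Fin.sum_univ_three, Matrix.diagonal, hJ, Fin.rev, Matrix.map_apply]
  have hGinv : (!![0, 0, ϖ; 0, 1, 0; σ ϖ, 0, 0] : Matrix (Fin 3) (Fin 3) K)⁻¹ = !![0, 0, (σ ϖ)⁻¹; 0, 1, 0; ϖ⁻¹, 0, 0] := by
    apply Matrix.inv_eq_left_inv
    ext i j
    fin_cases i <;> fin_cases j <;> simp [Matrix.mul_apply, Fin.sum_univ_three, hϖ0, hσϖ0]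
  rw [hG, hGinv]
  refine ⟨?_, ?_, ?_⟩
  · intro i j; fin_cases i <;> fin_cases j <;> simp [hϖ1, hσϖ1]
  · intro i j; fin_cases i <;> fin_cases j <;> simp [hϖ1, hϖ0, hvσ]
  · rw [Matrix.det_fin_three]; simp [pow_two, hvσ]

/-- **The apartment vertices `L′_a = latt diag(ϖ^a, 1, ϖ^{1−a})` are of type `2`** for ANY involution `σ` preserving `v` (`L′_a = diag(ϖ^a,1,(σϖ)^{−a}) · N₁`). [cite: BruhatTits1972, §10] [cite: Serre1980Trees, II.1.1] -/
theorem isVertexLattice_two_latt_diagonal_zpow_of_v (hσ : ∀ x, σ (σ x) = x) (hvσ : ∀ a, Valued.v (σ a) = Valued.v a) (hϖ : Valued.v ϖ = WithZero.exp (-1 : ℤ)) (a : ℤ) :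
    IsVertexLattice σ ϖ ((StdForm.antidiagonal 3).over K) 2 (latt (Matrix.diagonal ![ϖ ^ a, 1, ϖ ^ (1 - a)])) := by
  have hϖ0 : ϖ ≠ 0 := uniformizer_ne_zero hϖ
  obtain ⟨t, ht⟩ := exists_coe_eq_diagonal_zpow_of_involution (K := K) hσ hϖ0 a
  have h1 : latt (Matrix.diagonal ![ϖ ^ a, 1, ϖ ^ (1 - a)]) = mapGL (t : GL (Fin 3) K) (latt (Matrix.diagonal ![(1 : K), 1, ϖ])) := by
    rw [mapGL_coe_latt_eq t ht, diagonal_three_mul, mul_one, mul_one, latt_diagonal_map_zpow_mul_eq hvσ hϖ0, show -a + 1 = 1 - a by ring]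
  rw [h1]
  exact isVertexLattice_mapGL σ ϖ _ _ t.2 (isVertexLattice_two_N₁_of_v hvσ (uniformizer_mem_integer hϖ) hϖ0)

/-! ## §3 Duals of `ϖ`-power diagonal lattices, `σϖ`-free -/

/-- **`(latt diag(ϖ^a, ϖ^b, ϖ^c))^♯ = latt diag(ϖ^{−c}, ϖ^{−b}, ϖ^{−a})`** for ANY valuation-preserving `σ` (★ `dualLatt_latt_diagonal_antidiagonal`). [cite: Jacobowitz1962, §4] -/
theorem dualLatt_latt_diagonal_three_of_v (hvσ : ∀ a, Valued.v (σ a) = Valued.v a) (hϖ0 : ϖ ≠ 0) (a b c : ℤ) :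
    dualLatt σ ((StdForm.antidiagonal 3).over K) (latt (Matrix.diagonal ![ϖ ^ a, ϖ ^ b, ϖ ^ c])) = latt (Matrix.diagonal ![ϖ ^ (-c), ϖ ^ (-b), ϖ ^ (-a)]) := by
  have hd : ∀ i, (![ϖ ^ a, ϖ ^ b, ϖ ^ c] : Fin 3 → K) i ≠ 0 := by intro i; fin_cases i <;> exact zpow_ne_zero _ hϖ0
  rw [dualLatt_latt_diagonal_antidiagonal hvσ hd]
  congr 2; funext i; fin_cases i <;> simp [Fin.rev, zpow_neg]

/-! ## §4 The parent of a self-dual vertex, given its frame, for any isometric involution -/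

/-- **THE PARENT OF A SELF-DUAL VERTEX, ANY ISOMETRIC INVOLUTION** (`σ² = 1`, `|σ·| = |·|`, `|ϖ| = exp(−1)`; NO hypothesis on `σϖ`).  Let `L = κ·latt diag(ϖ^a,1,ϖ^{−a})`, `κ ∈ K₀`, be a
self-dual vertex IN A FRAME with `L ≠ 𝒪³`.  Then `depth L ≥ 1`, and `latticeParent σ ϖ J₀ L = L ⊓ ϖ^{1−depth}𝒪³` is a vertex of TYPE `2`, STRICTLY BELOW `L`, of the SAME depth.
★ `latticeParent_spec_of_isSelfDualLattice` with the frame as input and `hd ↦ (hσ, hvσ, hϖ)` (frames exist by Cartan + transitivity, filed separately).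
[cite: BruhatTits1972, §10] [cite: Serre1980Trees, II.1.1] -/
theorem latticeParent_spec_of_isSelfDualLattice_of_frame (hσ : ∀ x, σ (σ x) = x) (hvσ : ∀ a, Valued.v (σ a) = Valued.v a) (hϖ : Valued.v ϖ = WithZero.exp (-1 : ℤ))
    {κ : unitaryGroupOfForm σ ((StdForm.antidiagonal 3).over K)} (hκ : κ ∈ unitaryInt σ ((StdForm.antidiagonal 3).over K)) (a : ℤ)
    (hL0 : mapGL (κ : GL (Fin 3) K) (latt (Matrix.diagonal ![ϖ ^ a, 1, ϖ ^ (-a)])) ≠ stdLattice K 3) :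
    1 ≤ latticeDepth ϖ (mapGL (κ : GL (Fin 3) K) (latt (Matrix.diagonal ![ϖ ^ a, 1, ϖ ^ (-a)]))) ∧
    IsVertexLattice σ ϖ ((StdForm.antidiagonal 3).over K) 2 (latticeParent σ ϖ ((StdForm.antidiagonal 3).over K) (mapGL (κ : GL (Fin 3) K) (latt (Matrix.diagonal ![ϖ ^ a, 1, ϖ ^ (-a)])))) ∧
    latticeParent σ ϖ ((StdForm.antidiagonal 3).over K) (mapGL (κ : GL (Fin 3) K) (latt (Matrix.diagonal ![ϖ ^ a, 1, ϖ ^ (-a)]))) < mapGL (κ : GL (Fin 3) K) (latt (Matrix.diagonal ![ϖ ^ a, 1, ϖ ^ (-a)])) ∧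
    latticeDepth ϖ (latticeParent σ ϖ ((StdForm.antidiagonal 3).over K) (mapGL (κ : GL (Fin 3) K) (latt (Matrix.diagonal ![ϖ ^ a, 1, ϖ ^ (-a)])))) =
      latticeDepth ϖ (mapGL (κ : GL (Fin 3) K) (latt (Matrix.diagonal ![ϖ ^ a, 1, ϖ ^ (-a)]))) := by
  have hϖ0 : ϖ ≠ 0 := uniformizer_ne_zero hϖ
  -- `a ≠ 0`
  have ha0 : a ≠ 0 := by
    rintro rfl
    exact hL0 (by rw [latt_diagonal_zpow_zero, mapGL_stdLattice_of_mem_unitaryInt hκ])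
  -- depth `k = |a| ≥ 1`
  have hdepth : latticeDepth ϖ (mapGL (κ : GL (Fin 3) K) (latt (Matrix.diagonal ![ϖ ^ a, 1, ϖ ^ (-a)]))) = a.natAbs := by
    rw [latticeDepth_mapGL_of_mem_unitaryInt hκ, latticeDepth_latt_diagonal_zpow_selfDual hϖ]
  -- the parent in the frame
  have hsd := isSelfDualLattice_latt_diagonal_zpow_of_v (K := K) hσ hvσ hϖ a
  have hP : latticeParent σ ϖ ((StdForm.antidiagonal 3).over K) (mapGL (κ : GL (Fin 3) K) (latt (Matrix.diagonal ![ϖ ^ a, 1, ϖ ^ (-a)]))) =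
      mapGL (κ : GL (Fin 3) K) (latt (Matrix.diagonal ![ϖ ^ max a (1 - (a.natAbs : ℤ)), ϖ ^ max (0 : ℤ) (1 - (a.natAbs : ℤ)), ϖ ^ max (-a) (1 - (a.natAbs : ℤ))])) := by
    rw [latticeParent_mapGL_of_mem_unitaryInt hκ, latticeParent, dualLatt_eq_self_of_isSelfDualLattice hvσ isUnit_det_antidiagonal hsd,
      latticeDepth_latt_diagonal_zpow_selfDual hϖ, diagonal_one_mid_eq, latt_diagonal_three_inf_scaleLattice hϖ]
  -- the parent is of type two (both signs of `a`)
  have htwo : IsVertexLattice σ ϖ ((StdForm.antidiagonal 3).over K) 2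
      (latt (Matrix.diagonal ![ϖ ^ max a (1 - (a.natAbs : ℤ)), ϖ ^ max (0 : ℤ) (1 - (a.natAbs : ℤ)), ϖ ^ max (-a) (1 - (a.natAbs : ℤ))])) := by
    rcases le_or_gt 1 a with ha | ha
    · have h1 : max a (1 - (a.natAbs : ℤ)) = a := max_eq_left (by omega)
      have h2 : max (0 : ℤ) (1 - (a.natAbs : ℤ)) = 0 := max_eq_left (by omega)
      have h3 : max (-a) (1 - (a.natAbs : ℤ)) = 1 - a := by rw [max_eq_right (by omega)]; omega
      rw [h1, h2, h3, zpow_zero]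
      exact isVertexLattice_two_latt_diagonal_zpow_of_v hσ hvσ hϖ a
    · have h1 : max a (1 - (a.natAbs : ℤ)) = 1 + a := by rw [max_eq_right (by omega)]; omega
      have h2 : max (0 : ℤ) (1 - (a.natAbs : ℤ)) = 0 := max_eq_left (by omega)
      have h3 : max (-a) (1 - (a.natAbs : ℤ)) = -a := max_eq_left (by omega)
      rw [h1, h2, h3, zpow_zero, show -a = 1 - (1 + a) by ring]
      exact isVertexLattice_two_latt_diagonal_zpow_of_v hσ hvσ hϖ (1 + a)
  refine ⟨by rw [hdepth]; omega, ?_, ?_, ?_⟩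
  · -- type two
    rw [hP, isVertexLattice_mapGL_coe_iff]; exact htwo
  · -- strictly below
    refine lt_of_le_of_ne ?_ ?_
    · rw [latticeParent, dualLatt_eq_self_of_isSelfDualLattice hvσ isUnit_det_antidiagonal (isVertexLattice_mapGL σ ϖ _ _ κ.2 hsd)]
      exact inf_le_left
    · intro heq
      have h2 : IsVertexLattice σ ϖ ((StdForm.antidiagonal 3).over K) 2 (mapGL (κ : GL (Fin 3) K) (latt (Matrix.diagonal ![ϖ ^ a, 1, ϖ ^ (-a)]))) := by
        rw [← heq, hP, isVertexLattice_mapGL_coe_iff]; exact htwo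
      have h0 : IsVertexLattice σ ϖ ((StdForm.antidiagonal 3).over K) 0 (mapGL (κ : GL (Fin 3) K) (latt (Matrix.diagonal ![ϖ ^ a, 1, ϖ ^ (-a)]))) :=
        isVertexLattice_mapGL σ ϖ _ _ κ.2 hsd
      exact absurd (type_unique hvσ hϖ h2 h0) (by norm_num)
  · -- same depth
    rw [hP, latticeDepth_mapGL_of_mem_unitaryInt hκ, hdepth]
    rcases le_or_gt 1 a with ha | ha
    · have h1 : max a (1 - (a.natAbs : ℤ)) = a := max_eq_left (by omega)
      have h2 : max (0 : ℤ) (1 - (a.natAbs : ℤ)) = 0 := max_eq_left (by omega)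
      have h3 : max (-a) (1 - (a.natAbs : ℤ)) = 1 - a := by rw [max_eq_right (by omega)]; omega
      rw [h1, h2, h3, zpow_zero, latticeDepth_latt_diagonal_zpow_two hϖ]
      omega
    · have h1 : max a (1 - (a.natAbs : ℤ)) = 1 + a := by rw [max_eq_right (by omega)]; omega
      have h2 : max (0 : ℤ) (1 - (a.natAbs : ℤ)) = 0 := max_eq_left (by omega)
      have h3 : max (-a) (1 - (a.natAbs : ℤ)) = -a := max_eq_left (by omega)
      rw [h1, h2, h3, zpow_zero, show -a = 1 - (1 + a) by ring, latticeDepth_latt_diagonal_zpow_two hϖ]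
      omega

end Literature.NumberTheory.Automorphic.UnitaryLatticeTree

end
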